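import Summits.KontsevichZagierPeriods.KontsevichZagierPeriods.Theorems.RootDecompRelativeModAbsoluteCylLogSplitP22

/-! # `RootDecompRelativeModAbsoluteCylLogSplitP23` — part 23/25 of the mechanical ≤330-line split of `CylLogSplit.lean`
(split by the decomp-kz census seat for landing; mathematics unchanged; part 23 continues part 22). -/

noncomputable section
open Set MeasureTheory Filter Topology
open scoped BigOperators
open Literature.NumberTheory.Transcendental Literature.ModelTheory.ExponentialFields

namespace Summit.KontsevichZagierPeriods.RootDecompRelativeModAbsolute.Rung30571

namespace RegularisedLogLayer

namespace CylLog
variable {b : ℕ}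

/-- **(R1) — the σ-oriented `BoundaryRigidity` feed, PROVED from `BoundaryRigidity` by name.**  Over an open
`ℚ`-semialgebraic base `G`: σ-oriented pure-log cells `U_i` (`σ i`: `[band G 1 W_i, h_i/t]` with `W_i ≥ 1`;
`¬σ i`: `[band G W_i 1, h_i/t]` with `0 < W_i ≤ 1`, `W_i` differentiable), `h_i log W_i ∈ L¹(G)` and
`Σ_i h_i log W_i = 0` on `G` ⟹ `Σ_i (if σ i then 1 else −1) • [U_i] ∈ KZ.relations`. -/
theorem r1_of_boundaryRigidity
    (hBR : Summit.KontsevichZagierPeriods.LiouvilleUnfolding.LogPrimitiveNL.Negative.BoundaryRigidity)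
    {b k : ℕ} {G : Set (Fin b → ℝ)} (hGo : IsOpen G) (hG : IsSemialgebraic ℚ G)
    (h W : Fin k → (Fin b → ℝ) → ℝ) (hh : ∀ i, IsSemialgebraicFunOn ℚ G (h i))
    (hW : ∀ i, IsSemialgebraicFunOn ℚ G (W i)) (hWd : ∀ i, DifferentiableOn ℝ (W i) G)
    (σ : Fin k → Bool) (hσt : ∀ i, σ i = true → ∀ x ∈ G, 1 ≤ W i x)
    (hσf : ∀ i, σ i = false → ∀ x ∈ G, 0 < W i x ∧ W i x ≤ 1)
    (hint : ∀ i, IntegrableOn (fun x => h i x * Real.log (W i x)) G)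
    (hsum : ∀ x ∈ G, ∑ i, h i x * Real.log (W i x) = 0)
    (U : Fin k → KZ.IntegralRep (b + 1))
    (hUd : ∀ i, (U i).domain =
      if σ i then KZlog.band G (fun _ => 1) (W i) else KZlog.band G (W i) (fun _ => 1))
    (hUi : ∀ i, EqOn (U i).integrand (fun z => h i (Fin.init z) / z (Fin.last b)) (U i).domain) :
    ∑ i, (if σ i then (1:ℤ) else -1) • KZ.of (U i) ∈ KZ.relations := by
  have hW0 : ∀ i, ∀ x ∈ G, 0 < W i x := fun i x hx => by
    cases hσ : σ i
    · exact (hσf i hσ x hx).1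
    · linarith [hσt i hσ x hx]
  -- semialgebraicity of `W_i⁻¹` and `−h_i`
  have h1sa : IsSemialgebraicFunOn ℚ G (fun _ => (1:ℝ)) :=
    (isSemialgebraicFunOn_ratCast hG 1).congr fun _ _ => by simp
  have hWinv : ∀ i, IsSemialgebraicFunOn ℚ G (fun x => (W i x)⁻¹) := fun i =>
    (IsSemialgebraicFunOn.div h1sa (hW i) fun x hx => (hW0 i x hx).ne').congr fun x _ => by simp
  have hhneg : ∀ i, IsSemialgebraicFunOn ℚ G (fun x => -h i x) := fun i => (hh i).neg
  -- the re-oriented cells for `¬σ i`: `Ut i = [band G 1 W_i⁻¹, h_i/s]`, `Um i = [band G 1 W_i⁻¹, −h_i/s]`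
  have hex : ∀ i, ∃ Ut Um : KZ.IntegralRep (b + 1), σ i = false →
      Ut.domain = KZlog.band G (fun _ => 1) (fun x => (W i x)⁻¹) ∧
      (Ut.integrand = fun z => h i (Fin.init z) / z (Fin.last b)) ∧
      Um.domain = KZlog.band G (fun _ => 1) (fun x => (W i x)⁻¹) ∧
      (Um.integrand = fun z => -h i (Fin.init z) / z (Fin.last b)) := by
    intro i
    cases hσ : σ i
    · have hW1' : ∀ x ∈ G, 1 ≤ (W i x)⁻¹ := fun x hx =>
        (one_le_inv₀ (hσf i hσ x hx).1).2 (hσf i hσ x hx).2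
      have hint' : IntegrableOn (fun x => h i x * Real.log ((W i x)⁻¹)) G :=
        (hint i).neg.congr_fun (fun x _ => by simp [Real.log_inv]) hG.measurableSet_holds
      have hint'' : IntegrableOn (fun x => -h i x * Real.log ((W i x)⁻¹)) G :=
        (hint i).congr_fun (fun x _ => by simp [Real.log_inv]) hG.measurableSet_holds
      obtain ⟨Ut, hUtd, hUti⟩ := exists_logRep_of_integrableOn_log hG (hh i) (hWinv i) hW1' hint'
      obtain ⟨Um, hUmd, hUmi⟩ := exists_logRep_of_integrableOn_log hG (hhneg i) (hWinv i) hW1' hint''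
      exact ⟨Ut, Um, fun _ => ⟨hUtd, hUti, hUmd, hUmi⟩⟩
    · exact ⟨U i, U i, fun h => absurd h (by simp)⟩
  choose Ut Um hUtm using hex
  -- the BR family
  let h' : Fin k → (Fin b → ℝ) → ℝ := fun i => if σ i then h i else fun x => -h i x
  let W' : Fin k → (Fin b → ℝ) → ℝ := fun i => if σ i then W i else fun x => (W i x)⁻¹
  let V : Fin k → KZ.IntegralRep (b + 1) := fun i => if σ i then U i else Um i
  have hVf : ∀ i, σ i = false → V i = Um i := fun i hσ => by simp [V, hσ]
  have hVt : ∀ i, σ i = true → V i = U i := fun i hσ => by simp [V, hσ]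
  have hWf : ∀ i, σ i = false → W' i = fun x => (W i x)⁻¹ := fun i hσ => by simp [W', hσ]
  have hWt : ∀ i, σ i = true → W' i = W i := fun i hσ => by simp [W', hσ]
  have hhf : ∀ i, σ i = false → h' i = fun x => -h i x := fun i hσ => by simp [h', hσ]
  have hht : ∀ i, σ i = true → h' i = h i := fun i hσ => by simp [h', hσ]
  obtain ⟨g, hgd, hgi⟩ := KZ.exists_zeroRep hG
  have hh' : ∀ i, IsSemialgebraicFunOn ℚ g.domain (h' i) := fun i => by
    rw [hgd]
    cases hσ : σ i
    · rw [hhf i hσ]; exact hhneg i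
    · rw [hht i hσ]; exact hh i
  have hW' : ∀ i, IsSemialgebraicFunOn ℚ g.domain (W' i) := fun i => by
    rw [hgd]
    cases hσ : σ i
    · rw [hWf i hσ]; exact hWinv i
    · rw [hWt i hσ]; exact hW i
  have hW'1 : ∀ i, ∀ x ∈ g.domain, 1 ≤ W' i x := fun i x hx => by
    rw [hgd] at hx
    cases hσ : σ i
    · simp only [hWf i hσ]
      exact (one_le_inv₀ (hσf i hσ x hx).1).2 (hσf i hσ x hx).2
    · simp only [hWt i hσ]
      exact hσt i hσ x hx
  have hterm : ∀ i, ∀ x ∈ G, h' i x * Real.log (W' i x) = h i x * Real.log (W i x) := fun i x hx => by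
    cases hσ : σ i
    · simp [hhf i hσ, hWf i hσ, Real.log_inv]
    · simp [hht i hσ, hWt i hσ]
  have hVd : ∀ i, (V i).domain = {z | (Fin.init z : Fin b → ℝ) ∈ g.domain ∧ 1 ≤ z (Fin.last b) ∧
      z (Fin.last b) ≤ W' i (Fin.init z)} := fun i => by
    rw [hgd]
    cases hσ : σ i
    · rw [hVf i hσ, (hUtm i hσ).2.2.1, hWf i hσ]; rfl
    · rw [hVt i hσ, hUd i, if_pos hσ, hWt i hσ]; rfl
  have hVi : ∀ i, EqOn (V i).integrand (fun z => h' i (Fin.init z) / z (Fin.last b)) (V i).domain :=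
    fun i => by
    cases hσ : σ i
    · rw [hVf i hσ, (hUtm i hσ).2.2.2, hhf i hσ]; exact fun z _ => rfl
    · rw [hVt i hσ, hht i hσ]; exact hUi i
  have hVint : ∀ i, IntegrableOn (fun x => h' i x * Real.log (W' i x)) g.domain := fun i => by
    rw [hgd]; exact (hint i).congr_fun (fun x hx => (hterm i x hx).symm) hG.measurableSet_holds
  have hgsum : ∀ x ∈ g.domain, g.integrand x = ∑ i, h' i x * Real.log (W' i x) := fun x hx => by
    rw [hgd] at hx
    rw [hgi, Finset.sum_congr rfl fun i _ => hterm i x hx, hsum x hx]; rfl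
  have hBR' := hBR b k g h' W' V hh' hW' hW'1 hVd hVi hVint hgsum
  have hg0 : KZ.of g ∈ KZ.relations :=
    KZ.of_mem_relations_of_eqOn_zero g (by rw [hgi]; exact fun _ _ => rfl)
  -- `Σ (±1)•[U i] − Σ [V i] ∈ relations`, termwise
  have hdiff : ∀ i, (if σ i then (1:ℤ) else -1) • KZ.of (U i) - KZ.of (V i) ∈ KZ.relations := fun i => by
    cases hσ : σ i
    · obtain ⟨hUtd, hUti, hUmd, hUmi⟩ := hUtm i hσ
      -- re-orientation `[Ut] − [U] ∈ rel` (§3n) and sign flip `[Ut] + [Um] ∈ rel`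
      have h1 : KZ.of (Ut i) - KZ.of (U i) ∈ KZ.relations :=
        logCell_reorient_mem_relations hGo hG (hW i) (hWd i) (hW0 i) (Ut i) (U i) hUtd
          (by rw [hUti]; exact fun _ _ => rfl) (by rw [hUd i, if_neg (by simp [hσ])]) (hUi i)
      have h2 : KZ.of (Ut i) + KZ.of (Um i) ∈ KZ.relations :=
        KZ.of_add_of_mem_relations_of_eqOn_neg (by rw [hUmd, hUtd])
          (by rw [hUmi, hUti]; intro z _; simp [neg_div])
      have : (if false = true then (1:ℤ) else -1) • KZ.of (U i) - KZ.of (V i) =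
          (KZ.of (Ut i) - KZ.of (U i)) - (KZ.of (Ut i) + KZ.of (Um i)) := by
        rw [if_neg (by simp), hVf i hσ, neg_smul, one_smul]; abel
      rw [this]
      exact KZ.relations.sub_mem h1 h2
    · have : (if true = true then (1:ℤ) else -1) • KZ.of (U i) - KZ.of (V i) = 0 := by
        rw [if_pos rfl, hVt i hσ, one_smul, sub_self]
      rw [this]
      exact KZ.relations.zero_mem
  have hS : ∑ i, (if σ i then (1:ℤ) else -1) • KZ.of (U i) - ∑ i, KZ.of (V i) ∈ KZ.relations := by
    rw [← Finset.sum_sub_distrib]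
    exact sum_mem fun i _ => hdiff i
  have : ∑ i, (if σ i then (1:ℤ) else -1) • KZ.of (U i) =
      (∑ i, (if σ i then (1:ℤ) else -1) • KZ.of (U i) - ∑ i, KZ.of (V i)) +
        (∑ i, KZ.of (V i) - KZ.of g) + KZ.of g := by abel
  rw [this]
  exact KZ.relations.add_mem (KZ.relations.add_mem hS hBR') hg0

/-! ### §3ab D5/D6 ORDER TELESCOPE: `[P_M] ≡ (−1)^n [P_{M+n}] + Σ_{M≤j<M+n} (−1)^{j−M} [B_j]` (iterated `regOrder_raise`) — PROVED
Read upward it is D6 (raising every cell to the common exponent `m`); read downward (`M := 0`) it is the D5 lowering of a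
tame cell to the pure-log cell `P_0` fed to (R1).  Honesty of the cells `P_j` / base terms `B_j` stays with the caller
(§3o `exists_regRep_of_integrableOn_pow(')`, §3aa `exists_logRep_of_integrableOn_log`, `exists_baseRep_of_integrableOn`). -/

/-- A base representation with a prescribed `ℚ`-semialgebraic integrable integrand exists (structure constructor). -/
theorem exists_baseRep_of_integrableOn {b : ℕ} {G : Set (Fin b → ℝ)} (hG : IsSemialgebraic ℚ G)
    {F : (Fin b → ℝ) → ℝ} (hF : IsSemialgebraicFunOn ℚ G F) (hint : IntegrableOn F G) :
    ∃ B : KZ.IntegralRep b, B.domain = G ∧ B.integrand = F :=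
  ⟨{ domain := G, integrand := F, isSemialgebraic_domain := hG, isSemialgebraicFunOn_integrand := hF,
     integrableOn := hint }, rfl, rfl⟩

/-- **Order telescope (D5/D6).** On a band `[p, q]` (`p > 0`) with coefficient `c`: given honest cells `P_j = [band, c(t−1)^j/t]`
for `M ≤ j ≤ m` and honest base terms `B_j = [G, c((q−1)^{j+1} − (p−1)^{j+1})/(j+1)]` for `M ≤ j < m`,
`[P_M] − ((−1)^{m−M}•[P_m] + Σ_{j ∈ [M,m)} (−1)^{j−M}•[B_j]) ∈ KZ.relations`. -/
theorem regOrder_telescope {b M m : ℕ} (hMm : M ≤ m) {G : Set (Fin b → ℝ)} {c p q : (Fin b → ℝ) → ℝ}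
    (hc : IsSemialgebraicFunOn ℚ G c) (hp : IsSemialgebraicFunOn ℚ G p)
    (hq : IsSemialgebraicFunOn ℚ G q) (hp0 : ∀ x ∈ G, 0 < p x) (hpq : ∀ x ∈ G, p x ≤ q x)
    (P : ℕ → KZ.IntegralRep (b + 1)) (B : ℕ → KZ.IntegralRep b)
    (hPd : ∀ j, M ≤ j → j ≤ m → (P j).domain = KZlog.band G p q)
    (hPi : ∀ j, M ≤ j → j ≤ m → EqOn (P j).integrand
      (fun z => c (Fin.init z) * ((z (Fin.last b) - 1) ^ j / z (Fin.last b))) (P j).domain)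
    (hBd : ∀ j, M ≤ j → j < m → (B j).domain = G)
    (hBi : ∀ j, M ≤ j → j < m → EqOn (B j).integrand
      (fun x => c x * (((q x - 1) ^ (j + 1) - (p x - 1) ^ (j + 1)) / (j + 1))) (B j).domain) :
    KZ.of (P M) - ((-1:ℤ) ^ (m - M) • KZ.of (P m) +
      ∑ j ∈ Finset.Ico M m, (-1:ℤ) ^ (j - M) • KZ.of (B j)) ∈ KZ.relations := by
  -- induction on `n = m − M`
  have key : ∀ n, M + n ≤ m → KZ.of (P M) - ((-1:ℤ) ^ n • KZ.of (P (M + n)) +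
      ∑ j ∈ Finset.Ico M (M + n), (-1:ℤ) ^ (j - M) • KZ.of (B j)) ∈ KZ.relations := by
    intro n
    induction n with
    | zero =>
      intro _
      simp only [pow_zero, one_smul, add_zero, Finset.Ico_self, Finset.sum_empty, sub_self]
      exact KZ.relations.zero_mem
    | succ n ih =>
      intro hn
      have hn' : M + n ≤ m := by omega
      have X := ih hn'
      have R : KZ.of (P (M + n + 1)) + KZ.of (P (M + n)) - KZ.of (B (M + n)) ∈ KZ.relations :=
        regOrder_raise hc hp hq hp0 hpq (P (M + n + 1)) (P (M + n)) (B (M + n))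
          (hPd _ (by omega) (by omega)) (hPi _ (by omega) (by omega))
          (hPd _ (by omega) hn') (hPi _ (by omega) hn')
          (hBd _ (by omega) (by omega)) (hBi _ (by omega) (by omega))
      have hsum : ∑ j ∈ Finset.Ico M (M + (n + 1)), (-1:ℤ) ^ (j - M) • KZ.of (B j) =
          ∑ j ∈ Finset.Ico M (M + n), (-1:ℤ) ^ (j - M) • KZ.of (B j) + (-1:ℤ) ^ n • KZ.of (B (M + n)) := by
        rw [show M + (n + 1) = M + n + 1 by ring, Finset.sum_Ico_succ_top (by omega : M ≤ M + n),
          Nat.add_sub_cancel_left]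
      have : KZ.of (P M) - ((-1:ℤ) ^ (n + 1) • KZ.of (P (M + (n + 1))) +
          ∑ j ∈ Finset.Ico M (M + (n + 1)), (-1:ℤ) ^ (j - M) • KZ.of (B j)) =
          (KZ.of (P M) - ((-1:ℤ) ^ n • KZ.of (P (M + n)) +
            ∑ j ∈ Finset.Ico M (M + n), (-1:ℤ) ^ (j - M) • KZ.of (B j))) +
          (-1:ℤ) ^ n • (KZ.of (P (M + n + 1)) + KZ.of (P (M + n)) - KZ.of (B (M + n))) := by
        rw [hsum, show M + (n + 1) = M + n + 1 by ring, pow_succ]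
        module
      rw [this]
      exact KZ.relations.add_mem X (KZ.relations.zsmul_mem R _)
  have h := key (m - M) (by omega)
  rwa [Nat.add_sub_cancel' hMm] at h

/-! ### §3ac D8-TOP: the rung REDUCED to a PER-CELL closing statement `CellClose` — TYPED and the reduction PROVED
(`cylKernelZeroLog_of_cellClose`): smooth open full-measure sub-base (`KZ.exists_isOpen_contDiffOn`), common
refinement of the `q` sign partitions (§3x), a.e. ⇒ pointwise on each open cell (§3y), restriction of the cylinder
to the cells (§3v `exists_restrict_parts_ae`), domain additivity. -/

open scoped ContDiff in
/-- **`CellClose` — the per-cell residual of the rung `CylKernelZeroLog` (D8-top split).**  On an OPEN `ℚ`-sa cell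
`D ⊆ ℝ¹` on which every datum is `C^∞`, every `κᵢ` has a FIXED SIGN (`σ i = 0`: `κᵢ > 0`, `1`: `κᵢ < 0`, `2`:
`κᵢ ≡ 0`) and the integral identity `a₀ + Σ cᵢ ∫₀¹ θ^{Mᵢ}/(1+θκᵢ) dθ = 0` holds POINTWISE, the cylinder
representation lies in `KZ.relations`.  [this is where LogStructure (§3z `logStructure_cells`), (R1)
`r1_of_boundaryRigidity`, `RegTorusProductBands`/§3w, the order telescope §3ab and the analytic companions
`OneVarPowerBounds` / `OneVarLogTame` act; UNDECIDED · ATTACKABLE-NOW] -/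
def CellClose : Prop :=
  ∀ (D : Set (Fin 1 → ℝ)) (V : KZ.IntegralRep (1 + 1)) (a₀ : (Fin 1 → ℝ) → ℝ) (q : ℕ)
    (c κ : Fin q → (Fin 1 → ℝ) → ℝ) (M : Fin q → ℕ) (σ : Fin q → Fin 3),
    IsOpen D → IsSemialgebraic ℚ D →
    IsSemialgebraicFunOn ℚ D a₀ → ContDiffOn ℝ ∞ a₀ D → IntegrableOn a₀ D →
    (∀ i, IsSemialgebraicFunOn ℚ D (c i)) → (∀ i, ContDiffOn ℝ ∞ (c i) D) →
    (∀ i, IsSemialgebraicFunOn ℚ D (κ i)) → (∀ i, ContDiffOn ℝ ∞ (κ i) D) →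
    (∀ i, ∀ x ∈ D, -1 < κ i x) →
    (∀ i, σ i = 0 → ∀ x ∈ D, 0 < κ i x) → (∀ i, σ i = 1 → ∀ x ∈ D, κ i x < 0) →
    (∀ i, σ i = 2 → ∀ x ∈ D, κ i x = 0) →
    (∀ i, IntegrableOn (fun z : Fin (1 + 1) → ℝ =>
      c i (Fin.init z) * (z (Fin.last 1) ^ M i / (1 + z (Fin.last 1) * κ i (Fin.init z))))
      {z : Fin (1 + 1) → ℝ | (Fin.init z : Fin 1 → ℝ) ∈ D ∧ z (Fin.last 1) ∈ Set.Ioo 0 1}) →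
    (∀ i, IntegrableOn (fun x => c i x * ∫ θ in Set.Ioo (0 : ℝ) 1, θ ^ M i / (1 + θ * κ i x)) D) →
    V.domain = {z : Fin (1 + 1) → ℝ | (Fin.init z : Fin 1 → ℝ) ∈ D ∧ z (Fin.last 1) ∈ Set.Ioo 0 1} →
    Set.EqOn V.integrand (fun z => a₀ (Fin.init z) +
      ∑ i, c i (Fin.init z) * (z (Fin.last 1) ^ M i / (1 + z (Fin.last 1) * κ i (Fin.init z))))
      V.domain →
    (∀ x ∈ D, a₀ x + ∑ i, c i x * ∫ θ in Set.Ioo (0 : ℝ) 1, θ ^ M i / (1 + θ * κ i x) = 0) →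
    KZ.of V ∈ KZ.relations

open scoped ContDiff in
/-- An open `ℚ`-sa sub-base of full measure on which finitely many `ℚ`-sa functions are `C^∞`
(`KZ.exists_isOpen_contDiffOn`, intersected). -/
theorem exists_open_smooth_subset {b m : ℕ} {P : Set (Fin b → ℝ)} (hP : IsSemialgebraic ℚ P)
    (v : Fin m → (Fin b → ℝ) → ℝ) (hv : ∀ j, IsSemialgebraicFunOn ℚ P (v j)) :
    ∃ G : Set (Fin b → ℝ), G ⊆ P ∧ IsOpen G ∧ IsSemialgebraic ℚ G ∧ (∀ j, ContDiffOn ℝ ∞ (v j) G) ∧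
      volume (P \ G) = 0 := by
  have h0 : IsSemialgebraicFunOn ℚ P (fun _ => (0:ℝ)) :=
    (isSemialgebraicFunOn_ratCast hP 0).congr fun _ _ => by simp
  obtain ⟨G₀, hG₀P, hG₀o, hG₀, -, -, hn₀⟩ := KZ.exists_isOpen_contDiffOn hP h0
  choose G hGP hGo hG hsm hGd hGn using fun j => KZ.exists_isOpen_contDiffOn hP (hv j)
  have hIs : IsSemialgebraic ℚ (⋂ j, G j) := by
    simpa using IsSemialgebraic.biInter Finset.univ G fun j _ => hG j
  refine ⟨G₀ ∩ ⋂ j, G j, fun x hx => hG₀P hx.1, hG₀o.inter (isOpen_iInter_of_finite hGo), hG₀.inter hIs,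
    fun j => (hsm j).mono fun x hx => mem_iInter.mp hx.2 j, ?_⟩
  have hsub : P \ (G₀ ∩ ⋂ j, G j) ⊆ (P \ G₀) ∪ ⋃ j, (P \ G j) := by
    intro x hx
    by_cases h : x ∈ G₀
    · right
      have : ¬ x ∈ ⋂ j, G j := fun h' => hx.2 ⟨h, h'⟩
      rw [mem_iInter] at this
      push Not at this
      obtain ⟨j, hj⟩ := this
      exact mem_iUnion.mpr ⟨j, hx.1, hj⟩
    · exact Or.inl ⟨hx.1, h⟩
  exact measure_mono_null hsub (measure_union_null hn₀ (measure_iUnion_null fun j => hGn j))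

end CylLog
end RegularisedLogLayer
end Summit.KontsevichZagierPeriods.RootDecompRelativeModAbsolute.Rung30571
end
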